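import Summits.HodgeConjecture.HodgeConjecture.Theorems.F0P3SpectralPacketFactorisationH   -- ★ (N) FILE 3n (this seat): `SpectralPacketH.trH_partner_eq_trHSψ_mul_prod` (+ ★ 3k `toPureTensor_loc_eq_locAll`, ★ 3h `trHSψ` `evpHψ` `endoTrPkt`, ★ 1 `trPktH`)
import Literature.NumberTheory.Rogawski1990.ArchimedeanTransfer                           -- ★ `IsArchDeltaTransfer`, `ArchTransferFactor` (§14.3 at the archimedean component, relation form)
import HarnessLib

/-!
# (N) DEFS, FILE 3o — THE TWO `H`-SIDE LAWS OF (P1)-H AT THE TUPLE, NAMED: `SpectralPacketH.CharIdentityψ` («the local components of `ρ` obey the endoscopic character identities against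
# the `Δ″_v`-transfer on `G′_v`, read through `ψ_v`», Rogawski Thm. 13.1.1 (2) p. 198, Prop. 13.1.4 p. 199, §14.6 p. 237 l. −8, §14.3 p. 233) and `ArchPacketKitH.EndoTransferLaw`
# («the archimedean `H`-packet traces are the endoscopic sums on Δ-transfer pairs», Prop. 14.4.2 p. 236, Prop. 12.3.3 p. 178), and (P1)-H at the tuple modulo them

Cell `hodgecm-mathlib` (D-0151), F0∕P3 «U3-mult», crux H413 (`stmt-HodgeConjecture-24833`), route of record `HCCMUnconditional`.  (N) lead pen F0P3a-p01 (g12); BOARD rev. 2 (o1);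
LEAD F0P3a-plan (g10).  Definition lane (TWO `Prop`-predicates with explicit header binders ⇒ not relocated) + consumer theorems; box-before-file (B-typ03); `--supports
stmt-HodgeConjecture-24833 --as helper`.  No instance, no notation, no named fact, no `sorry`; never imports a `Cruxes/…/Lines` module — the binder TYPES of `Δ′ mH mG′ Tinf mHi mGi`
are the byte-shapes of the kit fields `𝔨.Δ 𝔨.mH 𝔨.mG Tinf 𝔨.mHi 𝔨.mGi` (`F0_T1InnerFormTraceIdentityKit.lean` :176–:214; Borel orbit quotients via `letI := borel` IN THE TYPES), so the junction
passes them verbatim, and the pin (xi″-c) conjuncts of ★ `IsPinned.deltaTransfer_tensors` are the hypotheses `hΔ` ∕ `harchΔ` below.  Twin of ★ FILE 3m on the `H`-side.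
HONEST LABEL: HC_CM is proved only modulo the printed citations until rung 0 closes; this file proves no printed statement — it NAMES the two families of character identities ★ FILE 3n
left as the hypotheses `hchar` ∕ `harchId` of (P1)-H, each in a print-true shape: (1) finite places — Thm. 13.1.1 (2) (dim `ρ_v ≠ 1`, `ρ_v ≠ i_H(χμ⁻¹)`) and Prop. 13.1.4 (dim `ρ_v = 1`,
`⟨ξ, ·⟩ ≡ 1` on the A-packet) give `Tr ρ_v(f^H) = Σ_{π ∈ ξ_H(ρ_v)} ⟨ρ_v, π⟩ Tr π(f)` for EVERY local component of a discrete `ρ` (p. 197: the excluded `i_H(χμ⁻¹)` «does not occur as a local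
component of an automorphic representation»), transported to `G′_v` by `Δ″_v(γ_H, γ′) = Δ_v(γ_H, ψ_v(γ′))` (p. 237 l. −8) — stated for the local components of THIS `ρ` (a law ON `ρ`, as
(TF-1)-H is); (2) archimedean places — at the PACKET level only (single discrete-series members are unstable at `ι`; cf. ★ FILE 3m).

CONTENTS.
* §1 (o1) **`SpectralPacketH.CharIdentityψ ρ ψ νG′ νH Δ′ mH mG′ : Prop`** := `∀ v f^H f′`, `IsLocSmooth f^H → IsLocSmooth f′ → IsLocalDeltaTransfer L H v (Δ′ v) (mH v) (mG′ v) f^H f′ →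
  (𝔩 v).trPktH (νH v) ρ_v f^H = (𝔩 v).endoTrPkt (ψ_* νG′ v) ρ_v (f′ ∘ ψ_v⁻¹)`; (o2) `isLocSmooth_toPureTensor_loc` (every factor of the record tensor `f′_{S,∞} ⊗ f^S` is `C_c^∞`);
  (o3) `CharIdentityψ.hchar` — the law at the pinned pair `(T^H_v, (f′_{S,∞} ⊗ f^S)_v)` IS ★ 3n's hypothesis `hchar`.
* §2 (o4) **`ArchPacketKitH.EndoTransferLaw 𝔞H L H Tinf mHi mGi archTrH archTr′ : Prop`** := `∀ P a^H a′`, `IsArchDeltaTransfer L H Tinf mHi mGi a^H a′ →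
  𝔞H.trPktInfH archTrH P a^H = 𝔞H.endoTrPktInf archTr′ P a′`.
* §3 (o5) **`SpectralPacketH.trH_partner_eq_trHSψ_mul_prod_of_laws`** — ★ 3n's (P1)-H with `hchar` ∕ `harchId` DISCHARGED from (o1) ∕ (o4) + the pin (xi″-c) relations:
  `Tr ρ(f′^H) = trHS S ρ f′_{S,∞} · ∏_{v ∈ supp f^S} vol′(K′_v) · evpH ρ v (f^S_v)`.

References: [Rogawski1990] §13.1 Thm. 13.1.1 (2) p. 198, Prop. 13.1.4 p. 199, p. 197; §14.3 p. 233; §14.4 Prop. 14.4.2 p. 236; §12.3 Prop. 12.3.3 p. 178; §14.6 p. 237 l. −8, p. 243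
l. 9–17; [Shelstad1983] (= [S₁] of Rogawski); [FlathCorvallis1979] Thm. 3.
-/

set_option autoImplicit false
-- the mandated namespace repeats `HodgeConjecture.HodgeConjecture`, as in every `Theorems/*.lean` of this sub-problem
set_option linter.dupNamespace false

noncomputable section

open NumberField IsDedekindDomain MeasureTheory Filter
open scoped Matrix MatrixGroups

open Literature.NumberTheory Literature.NumberTheory.Automorphic Literature.NumberTheory.Automorphic.UnitaryGroup
open Literature.NumberTheory.Rogawski1990 Literature.NumberTheory.GaloisRepresentations
open Literature.RepresentationTheory.BorelWallach2000 Literature.RepresentationTheory.KonnoKonno2007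
open Summit.HodgeConjecture.HodgeConjecture.Cruxes.H413.F0P3InnerFormClassificationV6 (TestH splitForm)
open Summit.HodgeConjecture.HodgeConjecture.Cruxes.H413.F0P3LocalPacketKit
open Summit.HodgeConjecture.HodgeConjecture.Cruxes.H413.F0P3ArchPacketKit
open Summit.HodgeConjecture.HodgeConjecture.Cruxes.H413.F0P3SemilocalTestFunctionsOfRecord (TestS₀ toPureTensor locAll isLocallyConstant_hasCompactSupport_locAll)
open Summit.HodgeConjecture.HodgeConjecture.Cruxes.H413.F0P3TestFunctionsOfRecord (Unr₀)

/-! ## §1 The finite-place law: the character identities of `ρ` on `G′_v` through `ψ_v` [Thm. 13.1.1 (2); Prop. 13.1.4; p. 237 l. −8; §14.3 p. 233] -/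

namespace Summit.HodgeConjecture.HodgeConjecture.Cruxes.H413.F0P3SpectralPacket

open Summit.HodgeConjecture.HodgeConjecture.Cruxes.H413.F0P3GlobalPacket
open Summit.HodgeConjecture.HodgeConjecture.Cruxes.H413.F0P3ArchPacketKit.ArchPacketKitH

variable {L : Type} [Field L] [NumberField L] [IsCMField L] {H : Matrix (Fin 3) (Fin 3) L} {ι : L →+* ℂ} {T : GL (Fin 3) ℂ}
  {hT : (T : Matrix (Fin 3) (Fin 3) ℂ)ᴴ * H.map ι * (T : Matrix (Fin 3) (Fin 3) ℂ) = Literature.Geometry.ComplexHyperbolic.BallModel.J}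
  {𝔩 : ∀ v : HeightOneSpectrum (𝓞 ↥(maximalRealSubfield L)), LocalPacketKit L (splitForm L 3) v} {𝔞 : ArchPacketKit} {𝔞H : ArchPacketKitH 𝔞}
  {DiscH : GlobalPacketH 𝔩 → 𝔞H.PktInfH → Prop}

/-- **(o2) Every local factor of the record tensor `f′_{S,∞} ⊗ f^S` is `C_c^∞`** (★ `isLocallyConstant_hasCompactSupport_locAll`, ★ 3k `toPureTensor_loc_eq_locAll`).
[cite: Rogawski1990, §14.2 p. 233; §1.6 p. 6] -/
theorem isLocSmooth_toPureTensor_loc (S : Finset (HeightOneSpectrum (𝓞 ↥(maximalRealSubfield L)))) (fS : TestS₀ L H ι T hT S) (fT : Unr₀ L H S) (v : HeightOneSpectrum (𝓞 ↥(maximalRealSubfield L))) :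
    IsLocSmooth ((toPureTensor S fS fT).loc v) := by
  rw [toPureTensor_loc_eq_locAll]
  exact isLocallyConstant_hasCompactSupport_locAll fS fT v

namespace SpectralPacketH

/-- **(o1) `ρ.CharIdentityψ ψ νG′ νH Δ′ mH mG′` — «THE LOCAL COMPONENTS OF `ρ` OBEY THE ENDOSCOPIC CHARACTER IDENTITIES AGAINST THE `Δ″_v`-TRANSFER ON `G′_v`, READ THROUGH `ψ_v`»**:
at every finite `v`, for every `Δ′_v`-matching pair of TEST functions `(f^H, f′)` on `H_v` and `G′_v = U(H)(L⁺_v)` (★ `IsLocSmooth`, ★ `IsLocalDeltaTransfer L H v (Δ′ v) (mH v) (mG′ v)`),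
`Σ_{σ ∈ ρ_v} Tr σ(f^H) = Σ_{π ∈ ξ_H(ρ_v)} ⟨ρ_v, π⟩ Tr π(f′ ∘ ψ_v⁻¹; ψ_{v*} νG′_v)` (★ FILE 1 `trPktH`, ★ FILE 3h `endoTrPkt`).  Print: Thm. 13.1.1 (2) and Prop. 13.1.4 give the identity
for every local component of a discrete `ρ` (p. 197: `i_H(χμ⁻¹)` never occurs), and for `v ∉ S₀` the transfer factor for `(G′_v, H_v)` is `Δ″_v(γ_H, γ′) = Δ_v(γ_H, ψ_v(γ′))`
(p. 237 l. −8), i.e. the `G_v`-identity transported along `ψ_v` (cf. ★ `F0P3bCharIdentityTransport`).  The hypothesis `hchar` of ★ FILE 3n at the pinned pair.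
[cite: Rogawski1990, §13.1 Thm. 13.1.1 (2) p. 198, Prop. 13.1.4 p. 199, p. 197; §14.6 p. 237 l. −8; §14.3 p. 233] -/
def CharIdentityψ (ρ : SpectralPacketH 𝔩 𝔞 𝔞H DiscH)
    (ψ : ∀ v : HeightOneSpectrum (𝓞 ↥(maximalRealSubfield L)), (cmDatum L 3 H).Local v ≃ₜ* (cmDatum L 3 (splitForm L 3)).Local v)
    [∀ v : HeightOneSpectrum (𝓞 ↥(maximalRealSubfield L)), MeasurableSpace ((cmDatum L 3 (splitForm L 3)).Local v)] [∀ v : HeightOneSpectrum (𝓞 ↥(maximalRealSubfield L)), MeasurableSpace ((cmDatum L 3 H).Local v)]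
    [∀ v : HeightOneSpectrum (𝓞 ↥(maximalRealSubfield L)), MeasurableSpace ((cmDatum L 2 (splitForm L 2)).Local v × (cmDatum L 1 (splitForm L 1)).Local v)]
    (νG' : ∀ v : HeightOneSpectrum (𝓞 ↥(maximalRealSubfield L)), Measure ((cmDatum L 3 H).Local v)) (νH : ∀ v : HeightOneSpectrum (𝓞 ↥(maximalRealSubfield L)), Measure ((cmDatum L 2 (splitForm L 2)).Local v × (cmDatum L 1 (splitForm L 1)).Local v))
    (Δ' : ∀ v : HeightOneSpectrum (𝓞 ↥(maximalRealSubfield L)), LocalTransferFactor L H v)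
    (mH : letI : ∀ (v : HeightOneSpectrum (𝓞 ↥(maximalRealSubfield L))) (a : (cmDatum L 2 (splitForm L 2)).Local v × (cmDatum L 1 (splitForm L 1)).Local v), MeasurableSpace (((cmDatum L 2 (splitForm L 2)).Local v × (cmDatum L 1 (splitForm L 1)).Local v) ⧸ Subgroup.centralizer ({a} : Set ((cmDatum L 2 (splitForm L 2)).Local v × (cmDatum L 1 (splitForm L 1)).Local v))) := fun _ _ => borel _;
      ∀ v : HeightOneSpectrum (𝓞 ↥(maximalRealSubfield L)), OrbitalMeasureFamily ((cmDatum L 2 (splitForm L 2)).Local v × (cmDatum L 1 (splitForm L 1)).Local v))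
    (mG' : letI : ∀ (v : HeightOneSpectrum (𝓞 ↥(maximalRealSubfield L))) (γ : (cmDatum L 3 H).Local v), MeasurableSpace ((cmDatum L 3 H).Local v ⧸ Subgroup.centralizer ({γ} : Set ((cmDatum L 3 H).Local v))) := fun _ _ => borel _;
      ∀ v : HeightOneSpectrum (𝓞 ↥(maximalRealSubfield L)), OrbitalMeasureFamily ((cmDatum L 3 H).Local v)) : Prop :=
  letI : ∀ (v : HeightOneSpectrum (𝓞 ↥(maximalRealSubfield L))) (a : (cmDatum L 2 (splitForm L 2)).Local v × (cmDatum L 1 (splitForm L 1)).Local v), MeasurableSpace (((cmDatum L 2 (splitForm L 2)).Local v × (cmDatum L 1 (splitForm L 1)).Local v) ⧸ Subgroup.centralizer ({a} : Set ((cmDatum L 2 (splitForm L 2)).Local v × (cmDatum L 1 (splitForm L 1)).Local v))) := fun _ _ => borel _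
  letI : ∀ (v : HeightOneSpectrum (𝓞 ↥(maximalRealSubfield L))) (γ : (cmDatum L 3 H).Local v), MeasurableSpace ((cmDatum L 3 H).Local v ⧸ Subgroup.centralizer ({γ} : Set ((cmDatum L 3 H).Local v))) := fun _ _ => borel _
  ∀ (v : HeightOneSpectrum (𝓞 ↥(maximalRealSubfield L))) (fH : (cmDatum L 2 (splitForm L 2)).Local v × (cmDatum L 1 (splitForm L 1)).Local v → ℂ) (f' : (cmDatum L 3 H).Local v → ℂ),
    IsLocSmooth fH → IsLocSmooth f' → IsLocalDeltaTransfer L H v (Δ' v) (mH v) (mG' v) fH f' →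
      (𝔩 v).trPktH (νH v) (ρ.fin.loc v) fH = (𝔩 v).endoTrPkt ((νG' v).map (ψ v)) (ρ.fin.loc v) (f' ∘ (ψ v).symm)

/-- **(o3) THE LAW AT THE PINNED PAIR IS ★ 3n's `hchar`**: for an unramified₂ pair tensor `T^H` with `C_c^∞` factors, `Δ′_v`-matched to the factors of `f′_{S,∞} ⊗ f^S` at every `v`
(pin (xi″-c) `IsPinned.deltaTransfer_tensors`), `Tr ρ_v(T^H_v) = Σ_{π ∈ ξ_H(ρ_v)} ⟨ρ_v, π⟩ Tr π((f′_{S,∞} ⊗ f^S)_v ∘ ψ_v⁻¹)`. [cite: Rogawski1990, §13.1 Thm. 13.1.1 (2) p. 198; §14.3 p. 233] -/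
theorem CharIdentityψ.hchar {ρ : SpectralPacketH 𝔩 𝔞 𝔞H DiscH}
    {ψ : ∀ v : HeightOneSpectrum (𝓞 ↥(maximalRealSubfield L)), (cmDatum L 3 H).Local v ≃ₜ* (cmDatum L 3 (splitForm L 3)).Local v}
    [∀ v : HeightOneSpectrum (𝓞 ↥(maximalRealSubfield L)), MeasurableSpace ((cmDatum L 3 (splitForm L 3)).Local v)] [∀ v : HeightOneSpectrum (𝓞 ↥(maximalRealSubfield L)), MeasurableSpace ((cmDatum L 3 H).Local v)]
    [∀ v : HeightOneSpectrum (𝓞 ↥(maximalRealSubfield L)), MeasurableSpace ((cmDatum L 2 (splitForm L 2)).Local v × (cmDatum L 1 (splitForm L 1)).Local v)]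
    {νG' : ∀ v : HeightOneSpectrum (𝓞 ↥(maximalRealSubfield L)), Measure ((cmDatum L 3 H).Local v)} {νH : ∀ v : HeightOneSpectrum (𝓞 ↥(maximalRealSubfield L)), Measure ((cmDatum L 2 (splitForm L 2)).Local v × (cmDatum L 1 (splitForm L 1)).Local v)}
    {Δ' : ∀ v : HeightOneSpectrum (𝓞 ↥(maximalRealSubfield L)), LocalTransferFactor L H v}
    {mH : letI : ∀ (v : HeightOneSpectrum (𝓞 ↥(maximalRealSubfield L))) (a : (cmDatum L 2 (splitForm L 2)).Local v × (cmDatum L 1 (splitForm L 1)).Local v), MeasurableSpace (((cmDatum L 2 (splitForm L 2)).Local v × (cmDatum L 1 (splitForm L 1)).Local v) ⧸ Subgroup.centralizer ({a} : Set ((cmDatum L 2 (splitForm L 2)).Local v × (cmDatum L 1 (splitForm L 1)).Local v))) := fun _ _ => borel _;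
      ∀ v : HeightOneSpectrum (𝓞 ↥(maximalRealSubfield L)), OrbitalMeasureFamily ((cmDatum L 2 (splitForm L 2)).Local v × (cmDatum L 1 (splitForm L 1)).Local v)}
    {mG' : letI : ∀ (v : HeightOneSpectrum (𝓞 ↥(maximalRealSubfield L))) (γ : (cmDatum L 3 H).Local v), MeasurableSpace ((cmDatum L 3 H).Local v ⧸ Subgroup.centralizer ({γ} : Set ((cmDatum L 3 H).Local v))) := fun _ _ => borel _;
      ∀ v : HeightOneSpectrum (𝓞 ↥(maximalRealSubfield L)), OrbitalMeasureFamily ((cmDatum L 3 H).Local v)}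
    (hlaw : ρ.CharIdentityψ ψ νG' νH Δ' mH mG') (S : Finset (HeightOneSpectrum (𝓞 ↥(maximalRealSubfield L)))) (fS : TestS₀ L H ι T hT S) (fT : Unr₀ L H S)
    {TH : UnitaryGroup.PureTensor₂ L (splitForm L 2) (splitForm L 1)} (hsH : ∀ v : HeightOneSpectrum (𝓞 ↥(maximalRealSubfield L)), IsLocSmooth (TH.loc v))
    (hΔ : letI : ∀ (v : HeightOneSpectrum (𝓞 ↥(maximalRealSubfield L))) (a : (cmDatum L 2 (splitForm L 2)).Local v × (cmDatum L 1 (splitForm L 1)).Local v), MeasurableSpace (((cmDatum L 2 (splitForm L 2)).Local v × (cmDatum L 1 (splitForm L 1)).Local v) ⧸ Subgroup.centralizer ({a} : Set ((cmDatum L 2 (splitForm L 2)).Local v × (cmDatum L 1 (splitForm L 1)).Local v))) := fun _ _ => borel _;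
      letI : ∀ (v : HeightOneSpectrum (𝓞 ↥(maximalRealSubfield L))) (γ : (cmDatum L 3 H).Local v), MeasurableSpace ((cmDatum L 3 H).Local v ⧸ Subgroup.centralizer ({γ} : Set ((cmDatum L 3 H).Local v))) := fun _ _ => borel _;
      ∀ v : HeightOneSpectrum (𝓞 ↥(maximalRealSubfield L)), IsLocalDeltaTransfer L H v (Δ' v) (mH v) (mG' v) (TH.loc v) ((toPureTensor S fS fT).loc v)) (v : HeightOneSpectrum (𝓞 ↥(maximalRealSubfield L))) :
    (𝔩 v).trPktH (νH v) (ρ.fin.loc v) (TH.loc v) = (𝔩 v).endoTrPkt ((νG' v).map (ψ v)) (ρ.fin.loc v) ((toPureTensor S fS fT).loc v ∘ (ψ v).symm) :=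
  hlaw v _ _ (hsH v) (isLocSmooth_toPureTensor_loc S fS fT v) (hΔ v)

end SpectralPacketH

end Summit.HodgeConjecture.HodgeConjecture.Cruxes.H413.F0P3SpectralPacket

/-! ## §2 The archimedean law: `H`-packet traces on Δ-transfer pairs [Prop. 14.4.2 p. 236; Prop. 12.3.3 p. 178; p. 243 l. 9–17] -/

namespace Summit.HodgeConjecture.HodgeConjecture.Cruxes.H413.F0P3ArchPacketKit.ArchPacketKitH

variable {𝔞 : ArchPacketKit}

/-- **(o4) `𝔞H.EndoTransferLaw L H Tinf mHi mGi archTrH archTr′` — «THE ARCHIMEDEAN `H`-PACKET TRACES ARE THE ENDOSCOPIC SUMS ON Δ-TRANSFER PAIRS»**: for every archimedean `H`-packet `P`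
and every pair `(a^H, a′)` on `H_∞` and `G′_∞ = U(H)(L⁺ ⊗ ℝ)` related by ★ `IsArchDeltaTransfer L H Tinf mHi mGi a^H a′` (matching κ-orbital integrals for the factor `Tinf`; Borel orbit
quotients), `Σ_{c ∈ P} archTrH c a^H = Σ_{c ∈ ξ_H(P)} ⟨P, c⟩ archTr′ c a′` (★ FILE 3g `trPktInfH`, `endoTrPktInf`).  Print: Prop. 14.4.2 p. 236 (compact places `v ∈ S₀`, relative to `Δ″_v`),
Prop. 12.3.3 p. 178 (the real place `ι`), as used on p. 243 l. 9–17; stated at the PACKET level only.  The hypothesis `harchId` of ★ FILE 3n.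
[cite: Rogawski1990, §14.4 Prop. 14.4.2 p. 236; §12.3 Prop. 12.3.3 p. 178; §14.6 p. 243 l. 9–17] [cite: Shelstad1983, main theorem] -/
def EndoTransferLaw (𝔞H : ArchPacketKitH 𝔞) (L : Type) [Field L] [NumberField L] [IsCMField L] (H : Matrix (Fin 3) (Fin 3) L) (Tinf : ArchTransferFactor L H)
    (mHi : letI : ∀ a : UnitaryGroup.arch (↥(maximalRealSubfield L)) L (IsCMField.complexConj L) 2 (splitForm L 2) × UnitaryGroup.arch (↥(maximalRealSubfield L)) L (IsCMField.complexConj L) 1 (splitForm L 1), MeasurableSpace ((UnitaryGroup.arch (↥(maximalRealSubfield L)) L (IsCMField.complexConj L) 2 (splitForm L 2) × UnitaryGroup.arch (↥(maximalRealSubfield L)) L (IsCMField.complexConj L) 1 (splitForm L 1)) ⧸ Subgroup.centralizer ({a} : Set (UnitaryGroup.arch (↥(maximalRealSubfield L)) L (IsCMField.complexConj L) 2 (splitForm L 2) × UnitaryGroup.arch (↥(maximalRealSubfield L)) L (IsCMField.complexConj L) 1 (splitForm L 1)))) := fun _ => borel _;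
      OrbitalMeasureFamily (UnitaryGroup.arch (↥(maximalRealSubfield L)) L (IsCMField.complexConj L) 2 (splitForm L 2) × UnitaryGroup.arch (↥(maximalRealSubfield L)) L (IsCMField.complexConj L) 1 (splitForm L 1)))
    (mGi : letI : ∀ γ : UnitaryGroup.arch (↥(maximalRealSubfield L)) L (IsCMField.complexConj L) 3 H, MeasurableSpace (UnitaryGroup.arch (↥(maximalRealSubfield L)) L (IsCMField.complexConj L) 3 H ⧸ Subgroup.centralizer ({γ} : Set (UnitaryGroup.arch (↥(maximalRealSubfield L)) L (IsCMField.complexConj L) 3 H))) := fun _ => borel _;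
      OrbitalMeasureFamily (UnitaryGroup.arch (↥(maximalRealSubfield L)) L (IsCMField.complexConj L) 3 H))
    (archTrH : 𝔞H.CinfH → (UnitaryGroup.arch (↥(maximalRealSubfield L)) L (IsCMField.complexConj L) 2 (splitForm L 2) × UnitaryGroup.arch (↥(maximalRealSubfield L)) L (IsCMField.complexConj L) 1 (splitForm L 1) → ℂ) → ℂ)
    (archTr' : GKIrrClass (uFormGroup (Fin 2) (Fin 1)) → (UnitaryGroup.arch (↥(maximalRealSubfield L)) L (IsCMField.complexConj L) 3 H → ℂ) → ℂ) : Prop :=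
  letI : ∀ a : UnitaryGroup.arch (↥(maximalRealSubfield L)) L (IsCMField.complexConj L) 2 (splitForm L 2) × UnitaryGroup.arch (↥(maximalRealSubfield L)) L (IsCMField.complexConj L) 1 (splitForm L 1), MeasurableSpace ((UnitaryGroup.arch (↥(maximalRealSubfield L)) L (IsCMField.complexConj L) 2 (splitForm L 2) × UnitaryGroup.arch (↥(maximalRealSubfield L)) L (IsCMField.complexConj L) 1 (splitForm L 1)) ⧸ Subgroup.centralizer ({a} : Set (UnitaryGroup.arch (↥(maximalRealSubfield L)) L (IsCMField.complexConj L) 2 (splitForm L 2) × UnitaryGroup.arch (↥(maximalRealSubfield L)) L (IsCMField.complexConj L) 1 (splitForm L 1)))) := fun _ => borel _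
  letI : ∀ γ : UnitaryGroup.arch (↥(maximalRealSubfield L)) L (IsCMField.complexConj L) 3 H, MeasurableSpace (UnitaryGroup.arch (↥(maximalRealSubfield L)) L (IsCMField.complexConj L) 3 H ⧸ Subgroup.centralizer ({γ} : Set (UnitaryGroup.arch (↥(maximalRealSubfield L)) L (IsCMField.complexConj L) 3 H))) := fun _ => borel _
  ∀ (P : 𝔞H.PktInfH) (aH : UnitaryGroup.arch (↥(maximalRealSubfield L)) L (IsCMField.complexConj L) 2 (splitForm L 2) × UnitaryGroup.arch (↥(maximalRealSubfield L)) L (IsCMField.complexConj L) 1 (splitForm L 1) → ℂ) (a' : UnitaryGroup.arch (↥(maximalRealSubfield L)) L (IsCMField.complexConj L) 3 H → ℂ),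
    IsArchDeltaTransfer L H Tinf mHi mGi aH a' → 𝔞H.trPktInfH archTrH P aH = 𝔞H.endoTrPktInf archTr' P a'

end Summit.HodgeConjecture.HodgeConjecture.Cruxes.H413.F0P3ArchPacketKit.ArchPacketKitH

/-! ## §3 (P1)-H at the tuple modulo the two laws [§14.6 p. 243 l. 9–17] -/

namespace Summit.HodgeConjecture.HodgeConjecture.Cruxes.H413.F0P3SpectralPacket.SpectralPacketH

open Summit.HodgeConjecture.HodgeConjecture.Cruxes.H413.F0P3GlobalPacket
open Summit.HodgeConjecture.HodgeConjecture.Cruxes.H413.F0P3ArchPacketKit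

variable {L : Type} [Field L] [NumberField L] [IsCMField L] {H : Matrix (Fin 3) (Fin 3) L} {ι : L →+* ℂ} {T : GL (Fin 3) ℂ}
  {hT : (T : Matrix (Fin 3) (Fin 3) ℂ)ᴴ * H.map ι * (T : Matrix (Fin 3) (Fin 3) ℂ) = Literature.Geometry.ComplexHyperbolic.BallModel.J}
  {𝔩 : ∀ v : HeightOneSpectrum (𝓞 ↥(maximalRealSubfield L)), LocalPacketKit L (splitForm L 3) v} {𝔞 : ArchPacketKit} {𝔞H : ArchPacketKitH 𝔞}
  {DiscH : GlobalPacketH 𝔩 → 𝔞H.PktInfH → Prop}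
  [∀ v : HeightOneSpectrum (𝓞 ↥(maximalRealSubfield L)), MeasurableSpace ((cmDatum L 3 (splitForm L 3)).Local v)]
  [∀ v : HeightOneSpectrum (𝓞 ↥(maximalRealSubfield L)), BorelSpace ((cmDatum L 3 (splitForm L 3)).Local v)]
  [∀ v : HeightOneSpectrum (𝓞 ↥(maximalRealSubfield L)), MeasurableSpace ((cmDatum L 3 H).Local v)]
  [∀ v : HeightOneSpectrum (𝓞 ↥(maximalRealSubfield L)), BorelSpace ((cmDatum L 3 H).Local v)]
  [∀ v : HeightOneSpectrum (𝓞 ↥(maximalRealSubfield L)), MeasurableSpace ((cmDatum L 2 (splitForm L 2)).Local v × (cmDatum L 1 (splitForm L 1)).Local v)]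
  [∀ v : HeightOneSpectrum (𝓞 ↥(maximalRealSubfield L)), BorelSpace ((cmDatum L 2 (splitForm L 2)).Local v × (cmDatum L 1 (splitForm L 1)).Local v)]
  {νG' : ∀ v : HeightOneSpectrum (𝓞 ↥(maximalRealSubfield L)), Measure ((cmDatum L 3 H).Local v)}
  [∀ v, (νG' v).IsMulLeftInvariant] [∀ v, IsFiniteMeasureOnCompacts (νG' v)]
  {νH : ∀ v : HeightOneSpectrum (𝓞 ↥(maximalRealSubfield L)), Measure ((cmDatum L 2 (splitForm L 2)).Local v × (cmDatum L 1 (splitForm L 1)).Local v)}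
  [∀ v, (νH v).IsMulLeftInvariant] [∀ v, IsFiniteMeasureOnCompacts (νH v)]
  {archTrH : 𝔞H.CinfH → (UnitaryGroup.arch (↥(maximalRealSubfield L)) L (IsCMField.complexConj L) 2 (splitForm L 2) × UnitaryGroup.arch (↥(maximalRealSubfield L)) L (IsCMField.complexConj L) 1 (splitForm L 1) → ℂ) → ℂ}

/-- **(o5) (P1)-H AT THE TUPLE MODULO THE LAWS (o1), (o4)**: for the pinned partner `f′^H = T^H.eval` of `f′ = f′_{S,∞} ⊗ f^S` (pin (xi″-c): `T^H` unramified₂ with `C_c^∞` factors,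
`Δ′_v`-matched to the factors of `f′` at every `v`, archimedean Δ-transfer `IsArchDeltaTransfer … T^H.arch f′_∞`), `Tr ρ(f′^H) = trHS S ρ f′_{S,∞} · ∏_{v ∈ supp f^S} vol′(K′_v)·evpH ρ v (f^S_v)`.
[cite: Rogawski1990, §14.6 p. 243 l. 9–17; §13.1 Thm. 13.1.1 (2) p. 198; §14.4 Prop. 14.4.2 p. 236; §13.7 p. 206] [cite: FlathCorvallis1979, Thm. 3] -/
theorem trH_partner_eq_trHSψ_mul_prod_of_laws (ρ : SpectralPacketH 𝔩 𝔞 𝔞H DiscH)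
    (ψ : ∀ v : HeightOneSpectrum (𝓞 ↥(maximalRealSubfield L)), (cmDatum L 3 H).Local v ≃ₜ* (cmDatum L 3 (splitForm L 3)).Local v)
    (h1 : ρ.UnramTraceOneH νH) (hadmH : ∀ (v : HeightOneSpectrum (𝓞 ↥(maximalRealSubfield L))), ∀ σ ∈ (𝔩 v).memH (ρ.fin.loc v), σ.IsAdmissible)
    (harch : ∀ (c : 𝔞H.CinfH) (k : ℂ) (f : UnitaryGroup.arch (↥(maximalRealSubfield L)) L (IsCMField.complexConj L) 2 (splitForm L 2) × UnitaryGroup.arch (↥(maximalRealSubfield L)) L (IsCMField.complexConj L) 1 (splitForm L 1) → ℂ), archTrH c (k • f) = k * archTrH c f)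
    (h1G : ρ.imageG.UnramTraceOne fun v => (νG' v).map (ψ v))
    (h4 : ∀ v : HeightOneSpectrum (𝓞 ↥(maximalRealSubfield L)), (𝔩 v).UnramLaw)
    (hadm : ∀ (v : HeightOneSpectrum (𝓞 ↥(maximalRealSubfield L))), ∀ π ∈ (𝔩 v).mem (ρ.imageG.loc v), π.IsAdmissible)
    (S₀ : Finset (HeightOneSpectrum (𝓞 ↥(maximalRealSubfield L))))
    (hgood : ∀ v ∉ S₀, ∀ r : SmoothIrrep ((UnitaryGroup.cmDatum L 3 (splitForm L 3)).Local v), r.ρ.IsAdmissible →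
      Module.finrank ℂ (r.ρ.fixedPoints (cmLocalIntegralLevel L 3 (splitForm L 3) v)) ≤ 1)
    (hψK : ∀ v ∉ S₀, (cmLocalIntegralLevel L 3 H v).map (ψ v : (cmDatum L 3 H).Local v →* (cmDatum L 3 (splitForm L 3)).Local v) =
      cmLocalIntegralLevel L 3 (splitForm L 3) v)
    (hμK : ∀ v : HeightOneSpectrum (𝓞 ↥(maximalRealSubfield L)), (νG' v).real (cmLocalIntegralLevel L 3 H v : Set ((cmDatum L 3 H).Local v)) ≠ 0)
    (S : Finset (HeightOneSpectrum (𝓞 ↥(maximalRealSubfield L)))) (hS₀ : S₀ ⊆ S) (hram : ρ.ramFinsetH ⊆ S)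
    (fS : TestS₀ L H ι T hT S) (fT : Unr₀ L H S)
    {TH : UnitaryGroup.PureTensor₂ L (splitForm L 2) (splitForm L 1)} (hTH : TH.IsUnramified₂) (hsH : ∀ v : HeightOneSpectrum (𝓞 ↥(maximalRealSubfield L)), IsLocSmooth (TH.loc v))
    {FH : TestH L} (hFH : ⇑FH = TH.eval)
    (archTr' : GKIrrClass (uFormGroup (Fin 2) (Fin 1)) → (UnitaryGroup.arch (↥(maximalRealSubfield L)) L (IsCMField.complexConj L) 3 H → ℂ) → ℂ)
    -- the finite-place law (o1) and the pin (xi″-c) finite relations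
    {Δ' : ∀ v : HeightOneSpectrum (𝓞 ↥(maximalRealSubfield L)), LocalTransferFactor L H v}
    {mH : letI : ∀ (v : HeightOneSpectrum (𝓞 ↥(maximalRealSubfield L))) (a : (cmDatum L 2 (splitForm L 2)).Local v × (cmDatum L 1 (splitForm L 1)).Local v), MeasurableSpace (((cmDatum L 2 (splitForm L 2)).Local v × (cmDatum L 1 (splitForm L 1)).Local v) ⧸ Subgroup.centralizer ({a} : Set ((cmDatum L 2 (splitForm L 2)).Local v × (cmDatum L 1 (splitForm L 1)).Local v))) := fun _ _ => borel _;
      ∀ v : HeightOneSpectrum (𝓞 ↥(maximalRealSubfield L)), OrbitalMeasureFamily ((cmDatum L 2 (splitForm L 2)).Local v × (cmDatum L 1 (splitForm L 1)).Local v)}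
    {mG' : letI : ∀ (v : HeightOneSpectrum (𝓞 ↥(maximalRealSubfield L))) (γ : (cmDatum L 3 H).Local v), MeasurableSpace ((cmDatum L 3 H).Local v ⧸ Subgroup.centralizer ({γ} : Set ((cmDatum L 3 H).Local v))) := fun _ _ => borel _;
      ∀ v : HeightOneSpectrum (𝓞 ↥(maximalRealSubfield L)), OrbitalMeasureFamily ((cmDatum L 3 H).Local v)}
    (hlaw : ρ.CharIdentityψ ψ νG' νH Δ' mH mG')
    (hΔ : letI : ∀ (v : HeightOneSpectrum (𝓞 ↥(maximalRealSubfield L))) (a : (cmDatum L 2 (splitForm L 2)).Local v × (cmDatum L 1 (splitForm L 1)).Local v), MeasurableSpace (((cmDatum L 2 (splitForm L 2)).Local v × (cmDatum L 1 (splitForm L 1)).Local v) ⧸ Subgroup.centralizer ({a} : Set ((cmDatum L 2 (splitForm L 2)).Local v × (cmDatum L 1 (splitForm L 1)).Local v))) := fun _ _ => borel _;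
      letI : ∀ (v : HeightOneSpectrum (𝓞 ↥(maximalRealSubfield L))) (γ : (cmDatum L 3 H).Local v), MeasurableSpace ((cmDatum L 3 H).Local v ⧸ Subgroup.centralizer ({γ} : Set ((cmDatum L 3 H).Local v))) := fun _ _ => borel _;
      ∀ v : HeightOneSpectrum (𝓞 ↥(maximalRealSubfield L)), IsLocalDeltaTransfer L H v (Δ' v) (mH v) (mG' v) (TH.loc v) ((toPureTensor S fS fT).loc v))
    -- the archimedean law (o4) and the pin (xi″-c) archimedean relation
    {Tinf : ArchTransferFactor L H}
    {mHi : letI : ∀ a : UnitaryGroup.arch (↥(maximalRealSubfield L)) L (IsCMField.complexConj L) 2 (splitForm L 2) × UnitaryGroup.arch (↥(maximalRealSubfield L)) L (IsCMField.complexConj L) 1 (splitForm L 1), MeasurableSpace ((UnitaryGroup.arch (↥(maximalRealSubfield L)) L (IsCMField.complexConj L) 2 (splitForm L 2) × UnitaryGroup.arch (↥(maximalRealSubfield L)) L (IsCMField.complexConj L) 1 (splitForm L 1)) ⧸ Subgroup.centralizer ({a} : Set (UnitaryGroup.arch (↥(maximalRealSubfield L)) L (IsCMField.complexConj L) 2 (splitForm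 L 2) × UnitaryGroup.arch (↥(maximalRealSubfield L)) L (IsCMField.complexConj L) 1 (splitForm L 1)))) := fun _ => borel _;
      OrbitalMeasureFamily (UnitaryGroup.arch (↥(maximalRealSubfield L)) L (IsCMField.complexConj L) 2 (splitForm L 2) × UnitaryGroup.arch (↥(maximalRealSubfield L)) L (IsCMField.complexConj L) 1 (splitForm L 1))}
    {mGi : letI : ∀ γ : UnitaryGroup.arch (↥(maximalRealSubfield L)) L (IsCMField.complexConj L) 3 H, MeasurableSpace (UnitaryGroup.arch (↥(maximalRealSubfield L)) L (IsCMField.complexConj L) 3 H ⧸ Subgroup.centralizer ({γ} : Set (UnitaryGroup.arch (↥(maximalRealSubfield L)) L (IsCMField.complexConj L) 3 H))) := fun _ => borel _;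
      OrbitalMeasureFamily (UnitaryGroup.arch (↥(maximalRealSubfield L)) L (IsCMField.complexConj L) 3 H)}
    (hlawInf : 𝔞H.EndoTransferLaw L H Tinf mHi mGi archTrH archTr')
    (harchΔ : letI : ∀ a : UnitaryGroup.arch (↥(maximalRealSubfield L)) L (IsCMField.complexConj L) 2 (splitForm L 2) × UnitaryGroup.arch (↥(maximalRealSubfield L)) L (IsCMField.complexConj L) 1 (splitForm L 1), MeasurableSpace ((UnitaryGroup.arch (↥(maximalRealSubfield L)) L (IsCMField.complexConj L) 2 (splitForm L 2) × UnitaryGroup.arch (↥(maximalRealSubfield L)) L (IsCMField.complexConj L) 1 (splitForm L 1)) ⧸ Subgroup.centralizer ({a} : Set (UnitaryGroup.arch (↥(maximalRealSubfield L)) L (IsCMField.complexConj L) 2 (splitForm L 2) × UnitaryGroup.arch (↥(maximalRealSubfield L)) L (IsCMField.complexConj L) 1 (splitForm L 1)))) := fun _ => borel _;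
      letI : ∀ γ : UnitaryGroup.arch (↥(maximalRealSubfield L)) L (IsCMField.complexConj L) 3 H, MeasurableSpace (UnitaryGroup.arch (↥(maximalRealSubfield L)) L (IsCMField.complexConj L) 3 H ⧸ Subgroup.centralizer ({γ} : Set (UnitaryGroup.arch (↥(maximalRealSubfield L)) L (IsCMField.complexConj L) 3 H))) := fun _ => borel _;
      IsArchDeltaTransfer L H Tinf mHi mGi TH.arch fS.arch) :
    ρ.trH νH archTrH FH =
      ρ.trHSψ ψ S (fun v => (νG' v).map (ψ v)) archTr' fS *
        ∏ v ∈ fT.T, (((νG' v).real (cmLocalIntegralLevel L 3 H v : Set ((cmDatum L 3 H).Local v)) : ℂ) * ρ.evpHψ ψ (fun w => (νG' w).map (ψ w)) v (fT.loc v)) :=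
  ρ.trH_partner_eq_trHSψ_mul_prod ψ h1 hadmH harch h1G h4 hadm S₀ hgood hψK hμK S hS₀ hram fS fT hTH (hlaw.hchar S fS fT hsH hΔ) hFH archTr'
    (hlawInf ρ.inf TH.arch fS.arch harchΔ)

end Summit.HodgeConjecture.HodgeConjecture.Cruxes.H413.F0P3SpectralPacket.SpectralPacketH

/-! ## §4 ED. 2 — THE GUARDED LAW `EndoTransferLawTest` (REF1 (g9) objection o361-1, R1-361 ∕ R1-363: repair adopted verbatim) and (P1)-H re-closed over it

(o4) `EndoTransferLaw` quantifies over ALL pairs `(a^H, a′)`.  The relation ★ `IsArchDeltaTransfer` only sees κ-orbital integrals at `G`-regular classes, none of which matches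
`1 ∈ G′_∞`, so it is blind to the value `a′ 1`; the closer's functional of record ★ `archTr₀ … x f` is `0` unless `f` is continuous and compactly supported.  Hence (o4) read at
`archTr′ := archTr₀ …` forces `𝔞H.trPktInfH archTrH P a^H = 0` and `𝔞H.endoTrPktInf archTr₀ P a′ = 0` for EVERY packet and EVERY Δ-pair (perturb `a′` at `1`) — kernel-checked by
REF1 (g9), `F0/P3a/F0P3a-ref1/g9/legs/R361_o361-1_EndoTransferLaw_probe.lean` ∕ `R363_o358-1_o361-1_ArchLaws_probe_v2.lean` (`RefProbe.endoTransferLaw_archTr₀_forces_vanishing`),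
print-false (Prop. 12.3.3 p. 178, Prop. 14.4.2 p. 236: the endoscopic character sums are non-zero distributions).  **(o4) is UNGUARDED — do not book it and do not instantiate
`hlawInf` of (o5) at `archTr₀`; both stay only as ★ names.**  The finite-place law (o1) `CharIdentityψ` IS guarded (`IsLocSmooth f^H → IsLocSmooth f′ →`) and is unaffected.
* (o6) **`ArchPacketKitH.EndoTransferLawTest`** := (o4) with both functions guarded by the print test classes `C_c^∞(H_∞)` = ★ `ArchSmooth₂` and `C_c^∞(G′_∞)` = ★ `ArchSmooth`
  (`ArchimedeanTransfer.lean` §2; the classes of ★ `ArchEndoscopicTransferExists` and of the kit pin (xi″-c), which carries `ArchSmooth₂ L T^H.arch`).  With the guard the law is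
  print-true at record for TEST functions (`archTr₀` agrees with the distribution character on `C_c^∞`); the probe's perturbation leaves the guarded class.
* (o7) `EndoTransferLaw.test` — the unguarded law implies the guarded one (bookkeeping only).
* (o8) **`SpectralPacketH.trH_partner_eq_trHSψ_mul_prod_of_testLaws`** — (o5) VERBATIM with `hlawInf : 𝔞H.EndoTransferLawTest …` and ONE extra binder `(haH : ArchSmooth₂ L T^H.arch)`
  (= the pin (xi″-c) conjunct), re-closed with `haH` and `fS.isArchTest` (★ `TestS₀`, body of `ArchSmooth`).
-/

namespace Summit.HodgeConjecture.HodgeConjecture.Cruxes.H413.F0P3ArchPacketKit.ArchPacketKitH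

variable {𝔞 : ArchPacketKit}

/-- **(o6) `𝔞H.EndoTransferLawTest L H Tinf mHi mGi archTrH archTr′` — «THE ARCHIMEDEAN `H`-PACKET TRACES ARE THE ENDOSCOPIC SUMS ON Δ-TRANSFER PAIRS OF TEST FUNCTIONS»** (ED. 2,
the GUARDED form of (o4); REF1 o361-1 repair): for every archimedean `H`-packet `P` and every pair `(a^H, a′)` of TEST functions — `a^H ∈ C_c^∞(H_∞)` in the sense of ★ `ArchSmooth₂`,
`a′ ∈ C_c^∞(G′_∞)` in the sense of ★ `ArchSmooth` (restrictions along the closed embeddings into `GL₃(L ⊗ ℝ)` of continuous, compactly supported, right-translation-smooth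
functions) — related by ★ `IsArchDeltaTransfer L H Tinf mHi mGi a^H a′` (matching κ-orbital integrals for the factor `Tinf`; Borel orbit quotients),
`Σ_{c ∈ P} archTrH c a^H = Σ_{c ∈ ξ_H(P)} ⟨P, c⟩ archTr′ c a′` (★ FILE 3g `trPktInfH`, `endoTrPktInf`).  Print: Prop. 14.4.2 p. 236 (compact places `v ∈ S₀`, relative to `Δ″_v`),
Prop. 12.3.3 p. 178 (the real place `ι`), as used on p. 243 l. 9–17, for `f^H_∞ ∈ C_c^∞(H_∞)` a Δ-transfer of `f′_∞ ∈ C_c^∞(G′_∞)` (§14.3 p. 234); PACKET level only.  This — not (o4) —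
is the archimedean hypothesis of (P1)-H to be booked.
[cite: Rogawski1990, §14.4 Prop. 14.4.2 p. 236; §12.3 Prop. 12.3.3 p. 178; §14.6 p. 243 l. 9–17; §14.3 p. 234] [cite: Shelstad1983, main theorem] [cite: BorelJacquet1979, §4.1] -/
def EndoTransferLawTest (𝔞H : ArchPacketKitH 𝔞) (L : Type) [Field L] [NumberField L] [IsCMField L] (H : Matrix (Fin 3) (Fin 3) L) (Tinf : ArchTransferFactor L H)
    (mHi : letI : ∀ a : UnitaryGroup.arch (↥(maximalRealSubfield L)) L (IsCMField.complexConj L) 2 (splitForm L 2) × UnitaryGroup.arch (↥(maximalRealSubfield L)) L (IsCMField.complexConj L) 1 (splitForm L 1), MeasurableSpace ((UnitaryGroup.arch (↥(maximalRealSubfield L)) L (IsCMField.complexConj L) 2 (splitForm L 2) × UnitaryGroup.arch (↥(maximalRealSubfield L)) L (IsCMField.complexConj L) 1 (splitForm L 1)) ⧸ Subgroup.centralizer ({a} : Set (UnitaryGroup.arch (↥(maximalRealSubfield L)) L (IsCMField.complexConj L) 2 (splitForm L 2) × UnitaryGroup.arch (↥(maximalRealSubfield L)) L (IsCMField.complexConj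 L) 1 (splitForm L 1)))) := fun _ => borel _;
      OrbitalMeasureFamily (UnitaryGroup.arch (↥(maximalRealSubfield L)) L (IsCMField.complexConj L) 2 (splitForm L 2) × UnitaryGroup.arch (↥(maximalRealSubfield L)) L (IsCMField.complexConj L) 1 (splitForm L 1)))
    (mGi : letI : ∀ γ : UnitaryGroup.arch (↥(maximalRealSubfield L)) L (IsCMField.complexConj L) 3 H, MeasurableSpace (UnitaryGroup.arch (↥(maximalRealSubfield L)) L (IsCMField.complexConj L) 3 H ⧸ Subgroup.centralizer ({γ} : Set (UnitaryGroup.arch (↥(maximalRealSubfield L)) L (IsCMField.complexConj L) 3 H))) := fun _ => borel _;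
      OrbitalMeasureFamily (UnitaryGroup.arch (↥(maximalRealSubfield L)) L (IsCMField.complexConj L) 3 H))
    (archTrH : 𝔞H.CinfH → (UnitaryGroup.arch (↥(maximalRealSubfield L)) L (IsCMField.complexConj L) 2 (splitForm L 2) × UnitaryGroup.arch (↥(maximalRealSubfield L)) L (IsCMField.complexConj L) 1 (splitForm L 1) → ℂ) → ℂ)
    (archTr' : GKIrrClass (uFormGroup (Fin 2) (Fin 1)) → (UnitaryGroup.arch (↥(maximalRealSubfield L)) L (IsCMField.complexConj L) 3 H → ℂ) → ℂ) : Prop :=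
  letI : ∀ a : UnitaryGroup.arch (↥(maximalRealSubfield L)) L (IsCMField.complexConj L) 2 (splitForm L 2) × UnitaryGroup.arch (↥(maximalRealSubfield L)) L (IsCMField.complexConj L) 1 (splitForm L 1), MeasurableSpace ((UnitaryGroup.arch (↥(maximalRealSubfield L)) L (IsCMField.complexConj L) 2 (splitForm L 2) × UnitaryGroup.arch (↥(maximalRealSubfield L)) L (IsCMField.complexConj L) 1 (splitForm L 1)) ⧸ Subgroup.centralizer ({a} : Set (UnitaryGroup.arch (↥(maximalRealSubfield L)) L (IsCMField.complexConj L) 2 (splitForm L 2) × UnitaryGroup.arch (↥(maximalRealSubfield L)) L (IsCMField.complexConj L) 1 (splitForm L 1)))) := fun _ => borel _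
  letI : ∀ γ : UnitaryGroup.arch (↥(maximalRealSubfield L)) L (IsCMField.complexConj L) 3 H, MeasurableSpace (UnitaryGroup.arch (↥(maximalRealSubfield L)) L (IsCMField.complexConj L) 3 H ⧸ Subgroup.centralizer ({γ} : Set (UnitaryGroup.arch (↥(maximalRealSubfield L)) L (IsCMField.complexConj L) 3 H))) := fun _ => borel _
  ∀ (P : 𝔞H.PktInfH) (aH : UnitaryGroup.arch (↥(maximalRealSubfield L)) L (IsCMField.complexConj L) 2 (splitForm L 2) × UnitaryGroup.arch (↥(maximalRealSubfield L)) L (IsCMField.complexConj L) 1 (splitForm L 1) → ℂ) (a' : UnitaryGroup.arch (↥(maximalRealSubfield L)) L (IsCMField.complexConj L) 3 H → ℂ),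
    ArchSmooth₂ L aH → ArchSmooth L 3 H a' →
    IsArchDeltaTransfer L H Tinf mHi mGi aH a' → 𝔞H.trPktInfH archTrH P aH = 𝔞H.endoTrPktInf archTr' P a'

/-- (o7) The unguarded law (o4) implies the guarded law (o6) (bookkeeping; (o4) itself is not to be booked — see the §4 header).
[cite: Rogawski1990, §14.4 Prop. 14.4.2 p. 236] -/
theorem EndoTransferLaw.test {𝔞H : ArchPacketKitH 𝔞} {L : Type} [Field L] [NumberField L] [IsCMField L] {H : Matrix (Fin 3) (Fin 3) L} {Tinf : ArchTransferFactor L H}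
    {mHi : letI : ∀ a : UnitaryGroup.arch (↥(maximalRealSubfield L)) L (IsCMField.complexConj L) 2 (splitForm L 2) × UnitaryGroup.arch (↥(maximalRealSubfield L)) L (IsCMField.complexConj L) 1 (splitForm L 1), MeasurableSpace ((UnitaryGroup.arch (↥(maximalRealSubfield L)) L (IsCMField.complexConj L) 2 (splitForm L 2) × UnitaryGroup.arch (↥(maximalRealSubfield L)) L (IsCMField.complexConj L) 1 (splitForm L 1)) ⧸ Subgroup.centralizer ({a} : Set (UnitaryGroup.arch (↥(maximalRealSubfield L)) L (IsCMField.complexConj L) 2 (splitForm L 2) × UnitaryGroup.arch (↥(maximalRealSubfield L)) L (IsCMField.complexConj L) 1 (splitForm L 1)))) := fun _ => borel _;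
      OrbitalMeasureFamily (UnitaryGroup.arch (↥(maximalRealSubfield L)) L (IsCMField.complexConj L) 2 (splitForm L 2) × UnitaryGroup.arch (↥(maximalRealSubfield L)) L (IsCMField.complexConj L) 1 (splitForm L 1))}
    {mGi : letI : ∀ γ : UnitaryGroup.arch (↥(maximalRealSubfield L)) L (IsCMField.complexConj L) 3 H, MeasurableSpace (UnitaryGroup.arch (↥(maximalRealSubfield L)) L (IsCMField.complexConj L) 3 H ⧸ Subgroup.centralizer ({γ} : Set (UnitaryGroup.arch (↥(maximalRealSubfield L)) L (IsCMField.complexConj L) 3 H))) := fun _ => borel _;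
      OrbitalMeasureFamily (UnitaryGroup.arch (↥(maximalRealSubfield L)) L (IsCMField.complexConj L) 3 H)}
    {archTrH : 𝔞H.CinfH → (UnitaryGroup.arch (↥(maximalRealSubfield L)) L (IsCMField.complexConj L) 2 (splitForm L 2) × UnitaryGroup.arch (↥(maximalRealSubfield L)) L (IsCMField.complexConj L) 1 (splitForm L 1) → ℂ) → ℂ}
    {archTr' : GKIrrClass (uFormGroup (Fin 2) (Fin 1)) → (UnitaryGroup.arch (↥(maximalRealSubfield L)) L (IsCMField.complexConj L) 3 H → ℂ) → ℂ}
    (h : 𝔞H.EndoTransferLaw L H Tinf mHi mGi archTrH archTr') : 𝔞H.EndoTransferLawTest L H Tinf mHi mGi archTrH archTr' :=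
  fun P aH a' _ _ hrel => h P aH a' hrel

end Summit.HodgeConjecture.HodgeConjecture.Cruxes.H413.F0P3ArchPacketKit.ArchPacketKitH

namespace Summit.HodgeConjecture.HodgeConjecture.Cruxes.H413.F0P3SpectralPacket.SpectralPacketH

open Summit.HodgeConjecture.HodgeConjecture.Cruxes.H413.F0P3GlobalPacket
open Summit.HodgeConjecture.HodgeConjecture.Cruxes.H413.F0P3ArchPacketKit

variable {L : Type} [Field L] [NumberField L] [IsCMField L] {H : Matrix (Fin 3) (Fin 3) L} {ι : L →+* ℂ} {T : GL (Fin 3) ℂ}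
  {hT : (T : Matrix (Fin 3) (Fin 3) ℂ)ᴴ * H.map ι * (T : Matrix (Fin 3) (Fin 3) ℂ) = Literature.Geometry.ComplexHyperbolic.BallModel.J}
  {𝔩 : ∀ v : HeightOneSpectrum (𝓞 ↥(maximalRealSubfield L)), LocalPacketKit L (splitForm L 3) v} {𝔞 : ArchPacketKit} {𝔞H : ArchPacketKitH 𝔞}
  {DiscH : GlobalPacketH 𝔩 → 𝔞H.PktInfH → Prop}
  [∀ v : HeightOneSpectrum (𝓞 ↥(maximalRealSubfield L)), MeasurableSpace ((cmDatum L 3 (splitForm L 3)).Local v)]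
  [∀ v : HeightOneSpectrum (𝓞 ↥(maximalRealSubfield L)), BorelSpace ((cmDatum L 3 (splitForm L 3)).Local v)]
  [∀ v : HeightOneSpectrum (𝓞 ↥(maximalRealSubfield L)), MeasurableSpace ((cmDatum L 3 H).Local v)]
  [∀ v : HeightOneSpectrum (𝓞 ↥(maximalRealSubfield L)), BorelSpace ((cmDatum L 3 H).Local v)]
  [∀ v : HeightOneSpectrum (𝓞 ↥(maximalRealSubfield L)), MeasurableSpace ((cmDatum L 2 (splitForm L 2)).Local v × (cmDatum L 1 (splitForm L 1)).Local v)]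
  [∀ v : HeightOneSpectrum (𝓞 ↥(maximalRealSubfield L)), BorelSpace ((cmDatum L 2 (splitForm L 2)).Local v × (cmDatum L 1 (splitForm L 1)).Local v)]
  {νG' : ∀ v : HeightOneSpectrum (𝓞 ↥(maximalRealSubfield L)), Measure ((cmDatum L 3 H).Local v)}
  [∀ v, (νG' v).IsMulLeftInvariant] [∀ v, IsFiniteMeasureOnCompacts (νG' v)]
  {νH : ∀ v : HeightOneSpectrum (𝓞 ↥(maximalRealSubfield L)), Measure ((cmDatum L 2 (splitForm L 2)).Local v × (cmDatum L 1 (splitForm L 1)).Local v)}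
  [∀ v, (νH v).IsMulLeftInvariant] [∀ v, IsFiniteMeasureOnCompacts (νH v)]
  {archTrH : 𝔞H.CinfH → (UnitaryGroup.arch (↥(maximalRealSubfield L)) L (IsCMField.complexConj L) 2 (splitForm L 2) × UnitaryGroup.arch (↥(maximalRealSubfield L)) L (IsCMField.complexConj L) 1 (splitForm L 1) → ℂ) → ℂ}

/-- **(o8) (P1)-H AT THE TUPLE MODULO THE LAW (o1) AND THE GUARDED ARCHIMEDEAN LAW (o6)** (ED. 2; supersedes (o5) for booking): for the pinned partner `f′^H = T^H.eval` of
`f′ = f′_{S,∞} ⊗ f^S` (pin (xi″-c): `T^H` unramified₂ with `C_c^∞` finite factors and `T^H.arch ∈ C_c^∞(H_∞)` (`haH`), `Δ′_v`-matched to the factors of `f′` at every `v`, archimedean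
Δ-transfer `IsArchDeltaTransfer … T^H.arch f′_∞`; `f′_∞ = fS.arch ∈ C_c^∞(G′_∞)` by ★ `TestS₀.isArchTest`), `Tr ρ(f′^H) = trHS S ρ f′_{S,∞} · ∏_{v ∈ supp f^S} vol′(K′_v)·evpH ρ v (f^S_v)`.
[cite: Rogawski1990, §14.6 p. 243 l. 9–17; §13.1 Thm. 13.1.1 (2) p. 198; §14.4 Prop. 14.4.2 p. 236; §14.3 p. 234; §13.7 p. 206] [cite: FlathCorvallis1979, Thm. 3] -/
theorem trH_partner_eq_trHSψ_mul_prod_of_testLaws (ρ : SpectralPacketH 𝔩 𝔞 𝔞H DiscH)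
    (ψ : ∀ v : HeightOneSpectrum (𝓞 ↥(maximalRealSubfield L)), (cmDatum L 3 H).Local v ≃ₜ* (cmDatum L 3 (splitForm L 3)).Local v)
    (h1 : ρ.UnramTraceOneH νH) (hadmH : ∀ (v : HeightOneSpectrum (𝓞 ↥(maximalRealSubfield L))), ∀ σ ∈ (𝔩 v).memH (ρ.fin.loc v), σ.IsAdmissible)
    (harch : ∀ (c : 𝔞H.CinfH) (k : ℂ) (f : UnitaryGroup.arch (↥(maximalRealSubfield L)) L (IsCMField.complexConj L) 2 (splitForm L 2) × UnitaryGroup.arch (↥(maximalRealSubfield L)) L (IsCMField.complexConj L) 1 (splitForm L 1) → ℂ), archTrH c (k • f) = k * archTrH c f)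
    (h1G : ρ.imageG.UnramTraceOne fun v => (νG' v).map (ψ v))
    (h4 : ∀ v : HeightOneSpectrum (𝓞 ↥(maximalRealSubfield L)), (𝔩 v).UnramLaw)
    (hadm : ∀ (v : HeightOneSpectrum (𝓞 ↥(maximalRealSubfield L))), ∀ π ∈ (𝔩 v).mem (ρ.imageG.loc v), π.IsAdmissible)
    (S₀ : Finset (HeightOneSpectrum (𝓞 ↥(maximalRealSubfield L))))
    (hgood : ∀ v ∉ S₀, ∀ r : SmoothIrrep ((UnitaryGroup.cmDatum L 3 (splitForm L 3)).Local v), r.ρ.IsAdmissible →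
      Module.finrank ℂ (r.ρ.fixedPoints (cmLocalIntegralLevel L 3 (splitForm L 3) v)) ≤ 1)
    (hψK : ∀ v ∉ S₀, (cmLocalIntegralLevel L 3 H v).map (ψ v : (cmDatum L 3 H).Local v →* (cmDatum L 3 (splitForm L 3)).Local v) =
      cmLocalIntegralLevel L 3 (splitForm L 3) v)
    (hμK : ∀ v : HeightOneSpectrum (𝓞 ↥(maximalRealSubfield L)), (νG' v).real (cmLocalIntegralLevel L 3 H v : Set ((cmDatum L 3 H).Local v)) ≠ 0)
    (S : Finset (HeightOneSpectrum (𝓞 ↥(maximalRealSubfield L)))) (hS₀ : S₀ ⊆ S) (hram : ρ.ramFinsetH ⊆ S)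
    (fS : TestS₀ L H ι T hT S) (fT : Unr₀ L H S)
    {TH : UnitaryGroup.PureTensor₂ L (splitForm L 2) (splitForm L 1)} (hTH : TH.IsUnramified₂) (hsH : ∀ v : HeightOneSpectrum (𝓞 ↥(maximalRealSubfield L)), IsLocSmooth (TH.loc v))
    (haH : ArchSmooth₂ L TH.arch) {FH : TestH L} (hFH : ⇑FH = TH.eval)
    (archTr' : GKIrrClass (uFormGroup (Fin 2) (Fin 1)) → (UnitaryGroup.arch (↥(maximalRealSubfield L)) L (IsCMField.complexConj L) 3 H → ℂ) → ℂ)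
    -- the finite-place law (o1) and the pin (xi″-c) finite relations
    {Δ' : ∀ v : HeightOneSpectrum (𝓞 ↥(maximalRealSubfield L)), LocalTransferFactor L H v}
    {mH : letI : ∀ (v : HeightOneSpectrum (𝓞 ↥(maximalRealSubfield L))) (a : (cmDatum L 2 (splitForm L 2)).Local v × (cmDatum L 1 (splitForm L 1)).Local v), MeasurableSpace (((cmDatum L 2 (splitForm L 2)).Local v × (cmDatum L 1 (splitForm L 1)).Local v) ⧸ Subgroup.centralizer ({a} : Set ((cmDatum L 2 (splitForm L 2)).Local v × (cmDatum L 1 (splitForm L 1)).Local v))) := fun _ _ => borel _;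
      ∀ v : HeightOneSpectrum (𝓞 ↥(maximalRealSubfield L)), OrbitalMeasureFamily ((cmDatum L 2 (splitForm L 2)).Local v × (cmDatum L 1 (splitForm L 1)).Local v)}
    {mG' : letI : ∀ (v : HeightOneSpectrum (𝓞 ↥(maximalRealSubfield L))) (γ : (cmDatum L 3 H).Local v), MeasurableSpace ((cmDatum L 3 H).Local v ⧸ Subgroup.centralizer ({γ} : Set ((cmDatum L 3 H).Local v))) := fun _ _ => borel _;
      ∀ v : HeightOneSpectrum (𝓞 ↥(maximalRealSubfield L)), OrbitalMeasureFamily ((cmDatum L 3 H).Local v)}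
    (hlaw : ρ.CharIdentityψ ψ νG' νH Δ' mH mG')
    (hΔ : letI : ∀ (v : HeightOneSpectrum (𝓞 ↥(maximalRealSubfield L))) (a : (cmDatum L 2 (splitForm L 2)).Local v × (cmDatum L 1 (splitForm L 1)).Local v), MeasurableSpace (((cmDatum L 2 (splitForm L 2)).Local v × (cmDatum L 1 (splitForm L 1)).Local v) ⧸ Subgroup.centralizer ({a} : Set ((cmDatum L 2 (splitForm L 2)).Local v × (cmDatum L 1 (splitForm L 1)).Local v))) := fun _ _ => borel _;
      letI : ∀ (v : HeightOneSpectrum (𝓞 ↥(maximalRealSubfield L))) (γ : (cmDatum L 3 H).Local v), MeasurableSpace ((cmDatum L 3 H).Local v ⧸ Subgroup.centralizer ({γ} : Set ((cmDatum L 3 H).Local v))) := fun _ _ => borel _;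
      ∀ v : HeightOneSpectrum (𝓞 ↥(maximalRealSubfield L)), IsLocalDeltaTransfer L H v (Δ' v) (mH v) (mG' v) (TH.loc v) ((toPureTensor S fS fT).loc v))
    -- the GUARDED archimedean law (o6) and the pin (xi″-c) archimedean relation
    {Tinf : ArchTransferFactor L H}
    {mHi : letI : ∀ a : UnitaryGroup.arch (↥(maximalRealSubfield L)) L (IsCMField.complexConj L) 2 (splitForm L 2) × UnitaryGroup.arch (↥(maximalRealSubfield L)) L (IsCMField.complexConj L) 1 (splitForm L 1), MeasurableSpace ((UnitaryGroup.arch (↥(maximalRealSubfield L)) L (IsCMField.complexConj L) 2 (splitForm L 2) × UnitaryGroup.arch (↥(maximalRealSubfield L)) L (IsCMField.complexConj L) 1 (splitForm L 1)) ⧸ Subgroup.centralizer ({a} : Set (UnitaryGroup.arch (↥(maximalRealSubfield L)) L (IsCMField.complexConj L) 2 (splitForm L 2) × UnitaryGroup.arch (↥(maximalRealSubfield L)) L (IsCMField.complexConj L) 1 (splitForm L 1)))) := fun _ => borel _;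
      OrbitalMeasureFamily (UnitaryGroup.arch (↥(maximalRealSubfield L)) L (IsCMField.complexConj L) 2 (splitForm L 2) × UnitaryGroup.arch (↥(maximalRealSubfield L)) L (IsCMField.complexConj L) 1 (splitForm L 1))}
    {mGi : letI : ∀ γ : UnitaryGroup.arch (↥(maximalRealSubfield L)) L (IsCMField.complexConj L) 3 H, MeasurableSpace (UnitaryGroup.arch (↥(maximalRealSubfield L)) L (IsCMField.complexConj L) 3 H ⧸ Subgroup.centralizer ({γ} : Set (UnitaryGroup.arch (↥(maximalRealSubfield L)) L (IsCMField.complexConj L) 3 H))) := fun _ => borel _;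
      OrbitalMeasureFamily (UnitaryGroup.arch (↥(maximalRealSubfield L)) L (IsCMField.complexConj L) 3 H)}
    (hlawInf : 𝔞H.EndoTransferLawTest L H Tinf mHi mGi archTrH archTr')
    (harchΔ : letI : ∀ a : UnitaryGroup.arch (↥(maximalRealSubfield L)) L (IsCMField.complexConj L) 2 (splitForm L 2) × UnitaryGroup.arch (↥(maximalRealSubfield L)) L (IsCMField.complexConj L) 1 (splitForm L 1), MeasurableSpace ((UnitaryGroup.arch (↥(maximalRealSubfield L)) L (IsCMField.complexConj L) 2 (splitForm L 2) × UnitaryGroup.arch (↥(maximalRealSubfield L)) L (IsCMField.complexConj L) 1 (splitForm L 1)) ⧸ Subgroup.centralizer ({a} : Set (UnitaryGroup.arch (↥(maximalRealSubfield L)) L (IsCMField.complexConj L) 2 (splitForm L 2) × UnitaryGroup.arch (↥(maximalRealSubfield L)) L (IsCMField.complexConj L) 1 (splitForm L 1)))) := fun _ => borel _;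
      letI : ∀ γ : UnitaryGroup.arch (↥(maximalRealSubfield L)) L (IsCMField.complexConj L) 3 H, MeasurableSpace (UnitaryGroup.arch (↥(maximalRealSubfield L)) L (IsCMField.complexConj L) 3 H ⧸ Subgroup.centralizer ({γ} : Set (UnitaryGroup.arch (↥(maximalRealSubfield L)) L (IsCMField.complexConj L) 3 H))) := fun _ => borel _;
      IsArchDeltaTransfer L H Tinf mHi mGi TH.arch fS.arch) :
    ρ.trH νH archTrH FH =
      ρ.trHSψ ψ S (fun v => (νG' v).map (ψ v)) archTr' fS *
        ∏ v ∈ fT.T, (((νG' v).real (cmLocalIntegralLevel L 3 H v : Set ((cmDatum L 3 H).Local v)) : ℂ) * ρ.evpHψ ψ (fun w => (νG' w).map (ψ w)) v (fT.loc v)) :=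
  ρ.trH_partner_eq_trHSψ_mul_prod ψ h1 hadmH harch h1G h4 hadm S₀ hgood hψK hμK S hS₀ hram fS fT hTH (hlaw.hchar S fS fT hsH hΔ) hFH archTr'
    (hlawInf ρ.inf TH.arch fS.arch haH fS.isArchTest harchΔ)

end Summit.HodgeConjecture.HodgeConjecture.Cruxes.H413.F0P3SpectralPacket.SpectralPacketH

end
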